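import Literature.Analysis.OperatorTheory.YangMillsMatrixModelEnergyBilinear
import HarnessLib

/-!
# Comparison calculus for Lüscher's matrix-model Hamiltonian: the quartic bound on the potential and the explicit comparison function
# `e^{−a(1+‖x‖²)²}` with its Laplacian (part 1 of the elementary ground-state LOWER bound)

Topic `Literature/Analysis/OperatorTheory`.  Elementary calculus in the tree's `pderiv`/`laplacian` vocabulary on `ℝ⁹ = ZM`, used by
`YangMillsMatrixModelGroundStateLowerBound.lean` (the quotient maximum principle and the lower bound `ψ ≥ c·e^{−a‖y‖⁴}` for positive
eigenfunctions of `𝔥 = −½Δ + V`):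
* §1 `luscherPotential_le_norm_pow_four`: `V(x) ≤ ¼‖x‖⁴` (Lagrange's identity `|u×v|² = |u|²|v|² − (u·v)²`);
* §2 `∂_p` of coordinates, of `‖x‖²`, of `e^{g}`; for `φ = e^{−a(1+‖x‖²)²}`: `∂_pφ = −4a(1+‖x‖²)x_p φ`,
  `∂_p∂_pφ = φ(16a²(1+‖x‖²)²x_p² − 4a(2x_p² + 1 + ‖x‖²))`, **`Δφ = φ(16a²(1+‖x‖²)²‖x‖² − 4a(11‖x‖² + 9))`** (`laplacian_cmp`);
(The interior-maximum conditions and the quotient comparison principle are the tree's `YangMillsMatrixModelGroundStateComparison.lean`,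
seat ym-20205-polyakovlift-s1 g3, landed concurrently; this file only supplies the explicit comparison function.)

All theorems, 0 sorry, no definitions, no named facts.  [cite: Agmon1982, §1 (weights `e^{h}`, (1.10)), Ch. 5 remarks pp. 81–82]
-/

noncomputable section

open MeasureTheory Filter Topology Function Metric Matrix
open scoped BigOperators

namespace Literature.Analysis.OperatorTheory.YMMatrixModel

/-! ### §1. The quartic upper bound on the potential -/

/-- `|u × v|² ≤ |u|²|v|²` (Lagrange's identity). [cite: SimonB1983DiscreteSpectrum, eq. (3) p. 211] -/
theorem cross_dot_cross_self_le (u v : Fin 3 → ℝ) : (u ⨯₃ v) ⬝ᵥ (u ⨯₃ v) ≤ (u ⬝ᵥ u) * (v ⬝ᵥ v) := by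
  rw [cross_dot_cross, dotProduct_comm v u]
  nlinarith [mul_self_nonneg (u ⬝ᵥ v)]

/-- `x_i · x_i = Σ_a x(i,a)²`. [cite: SimonB1983DiscreteSpectrum, eq. (3) p. 211] -/
theorem colourVec_dot_self (x : ZM) (i : Fin 3) : colourVec x i ⬝ᵥ colourVec x i = ∑ a, x (i, a) ^ 2 := by
  simp [dotProduct, colourVec, sq]

/-- `Σ_i x_i · x_i = ‖x‖²`. [cite: SimonB1983DiscreteSpectrum, eq. (3) p. 211] -/
theorem sum_colourVec_dot_self (x : ZM) : ∑ i, colourVec x i ⬝ᵥ colourVec x i = ‖x‖ ^ 2 := by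
  simp_rw [colourVec_dot_self]
  rw [EuclideanSpace.real_norm_sq_eq, Fintype.sum_prod_type]

/-- **`V(x) ≤ ¼‖x‖⁴`** for Lüscher's potential `V = ¼Σ_{i,j}|x_i × x_j|²`. [cite: SimonB1983DiscreteSpectrum, eq. (3) p. 211] -/
theorem luscherPotential_le_norm_pow_four (x : ZM) : luscherPotential x ≤ (1 / 4 : ℝ) * ‖x‖ ^ 4 := by
  unfold luscherPotential
  have h : ∑ i : Fin 3, ∑ j : Fin 3, (colourVec x i ⨯₃ colourVec x j) ⬝ᵥ (colourVec x i ⨯₃ colourVec x j) ≤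
      ∑ i : Fin 3, ∑ j : Fin 3, (colourVec x i ⬝ᵥ colourVec x i) * (colourVec x j ⬝ᵥ colourVec x j) :=
    Finset.sum_le_sum fun i _ => Finset.sum_le_sum fun j _ => cross_dot_cross_self_le _ _
  have e : ∑ i : Fin 3, ∑ j : Fin 3, (colourVec x i ⬝ᵥ colourVec x i) * (colourVec x j ⬝ᵥ colourVec x j) = (‖x‖ ^ 2) ^ 2 := by
    rw [← sum_colourVec_dot_self, sq, Finset.sum_mul_sum]
  rw [e] at h
  have e4 : (‖x‖ ^ 2) ^ 2 = ‖x‖ ^ 4 := by ring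
  rw [e4] at h
  linarith

/-! ### §2. Calculus of the comparison function `e^{−a(1+‖x‖²)²}` -/

section Calculus

variable {g : ZM → ℝ}

/-- `⟪x, e_p⟫ = x_p`. [cite: Agmon1982, §1 (1.10)] -/
theorem inner_unitDir (x : ZM) (p : Fin 3 × Fin 3) : inner ℝ x (unitDir p) = x p := by
  rw [unitDir, EuclideanSpace.inner_single_right]; simp

/-- `∂_p` of a constant vanishes. [cite: Agmon1982, §1 (1.10)] -/
theorem pderiv_const' (c : ℝ) (p : Fin 3 × Fin 3) (x : ZM) : pderiv p (fun _ : ZM => c) x = 0 := by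
  simp [pderiv]

/-- The coordinate function as an inner product: `y_p = ⟪y, e_p⟫`, with its derivative. [cite: Agmon1982, §1 (1.10)] -/
theorem hasFDerivAt_coord (p : Fin 3 × Fin 3) (x : ZM) : HasFDerivAt (fun y : ZM => y p) (innerSL ℝ (unitDir p)) x := by
  have h := (innerSL ℝ (unitDir p)).hasFDerivAt (x := x)
  refine h.congr_of_eventuallyEq (Eventually.of_forall fun y => ?_)
  show y p = innerSL ℝ (unitDir p) y
  rw [innerSL_apply_apply, real_inner_comm, inner_unitDir]

/-- `∂_p x_p = 1`. [cite: Agmon1982, §1 (1.10)] -/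
theorem pderiv_coord_self (p : Fin 3 × Fin 3) (x : ZM) : pderiv p (fun y : ZM => y p) x = 1 := by
  rw [pderiv, (hasFDerivAt_coord p x).fderiv, innerSL_apply_apply, real_inner_comm, inner_unitDir, unitDir_apply, if_pos rfl]

/-- The coordinate function is differentiable. [cite: Agmon1982, §1 (1.10)] -/
theorem differentiable_coord (p : Fin 3 × Fin 3) : Differentiable ℝ fun y : ZM => y p :=
  fun x => (hasFDerivAt_coord p x).differentiableAt

/-- `∂_p ‖x‖² = 2x_p`. [cite: Agmon1982, §1 (1.10)] -/
theorem pderiv_norm_sq (p : Fin 3 × Fin 3) (x : ZM) : pderiv p (fun y : ZM => ‖y‖ ^ 2) x = 2 * x p := by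
  rw [pderiv, (hasStrictFDerivAt_norm_sq x).hasFDerivAt.fderiv]
  simp [inner_unitDir]

/-- `∂_p (1 + ‖x‖²) = 2x_p`. [cite: Agmon1982, §1 (1.10)] -/
theorem pderiv_one_add_norm_sq (p : Fin 3 × Fin 3) (x : ZM) : pderiv p (fun y : ZM => 1 + ‖y‖ ^ 2) x = 2 * x p := by
  have h1 : HasFDerivAt (fun y : ZM => 1 + ‖y‖ ^ 2) ((2 : ℕ) • innerSL ℝ x) x := by
    have := ((hasStrictFDerivAt_norm_sq x).hasFDerivAt).const_add 1
    simpa using this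
  rw [pderiv, h1.fderiv]
  simp [inner_unitDir]

/-- `1 + ‖·‖²` is smooth. [cite: Agmon1982, §1 (1.10)] -/
theorem contDiff_one_add_norm_sq {n : WithTop ℕ∞} : ContDiff ℝ n fun y : ZM => 1 + ‖y‖ ^ 2 :=
  contDiff_const.add (contDiff_norm_sq ℝ)

/-- `1 + ‖·‖²` is differentiable. [cite: Agmon1982, §1 (1.10)] -/
theorem differentiable_one_add_norm_sq : Differentiable ℝ fun y : ZM => 1 + ‖y‖ ^ 2 :=
  (contDiff_one_add_norm_sq (n := 1)).differentiable one_ne_zero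

/-- Chain rule for the exponential: `∂_p e^{g} = e^{g} ∂_p g`. [cite: Agmon1982, §1 (1.10)] -/
theorem pderiv_exp (hg : Differentiable ℝ g) (p : Fin 3 × Fin 3) (x : ZM) :
    pderiv p (fun y => Real.exp (g y)) x = Real.exp (g x) * pderiv p g x := by
  rw [pderiv, ((hg x).hasFDerivAt.exp).fderiv, pderiv]
  simp [smul_eq_mul]

/-- Leibniz rule in the `fun`-form. [cite: Agmon1982, §1 (1.10)] -/
theorem pderiv_fun_mul {u v : ZM → ℝ} (hu : Differentiable ℝ u) (hv : Differentiable ℝ v) (p : Fin 3 × Fin 3) (x : ZM) :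
    pderiv p (fun y => u y * v y) x = pderiv p u x * v x + u x * pderiv p v x :=
  pderiv_mul hu hv p x

/-- `∂_p (c·u) = c ∂_p u` in the `fun`-form. [cite: Agmon1982, §1 (1.10)] -/
theorem pderiv_fun_const_mul {u : ZM → ℝ} (hu : Differentiable ℝ u) (c : ℝ) (p : Fin 3 × Fin 3) (x : ZM) :
    pderiv p (fun y => c * u y) x = c * pderiv p u x := by
  have := pderiv_smul hu c p x
  simpa [Pi.smul_def, smul_eq_mul] using this

/-- Leibniz rule in the `fun`-form for sums. [cite: Agmon1982, Ch. 5, remarks pp. 81–82] -/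
theorem pderiv_fun_add {u v : ZM → ℝ} (hu : Differentiable ℝ u) (hv : Differentiable ℝ v) (p : Fin 3 × Fin 3) (x : ZM) :
    pderiv p (fun y => u y + v y) x = pderiv p u x + pderiv p v x :=
  pderiv_add hu hv p x

variable (a : ℝ)

/-- The exponent `h(x) = a(1 + ‖x‖²)²` is smooth. [cite: Agmon1982, §1 (1.10)] -/
theorem contDiff_quarticExp {n : WithTop ℕ∞} : ContDiff ℝ n fun y : ZM => a * (1 + ‖y‖ ^ 2) ^ 2 :=
  contDiff_const.mul (contDiff_one_add_norm_sq.pow 2)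

/-- `∂_p (a(1+‖x‖²)²) = 4a(1+‖x‖²)x_p`. [cite: Agmon1982, §1 (1.10)] -/
theorem pderiv_quarticExp (p : Fin 3 × Fin 3) (x : ZM) :
    pderiv p (fun y : ZM => a * (1 + ‖y‖ ^ 2) ^ 2) x = 4 * a * (1 + ‖x‖ ^ 2) * x p := by
  have hq := differentiable_one_add_norm_sq
  have hqq : Differentiable ℝ fun y : ZM => (1 + ‖y‖ ^ 2) * (1 + ‖y‖ ^ 2) := hq.mul hq
  have e : (fun y : ZM => a * (1 + ‖y‖ ^ 2) ^ 2) = fun y => a * ((1 + ‖y‖ ^ 2) * (1 + ‖y‖ ^ 2)) := by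
    funext y; ring
  rw [e, pderiv_fun_const_mul hqq, pderiv_fun_mul hq hq, pderiv_one_add_norm_sq]
  ring

/-- The comparison function `φ(x) = e^{−a(1+‖x‖²)²}` is smooth. [cite: Agmon1982, §1 (1.10)] -/
theorem contDiff_cmp {n : WithTop ℕ∞} : ContDiff ℝ n fun y : ZM => Real.exp (-(a * (1 + ‖y‖ ^ 2) ^ 2)) :=
  (contDiff_quarticExp a).neg.exp

/-- `φ` is differentiable. [cite: Agmon1982, §1 (1.10)] -/
theorem differentiable_cmp : Differentiable ℝ fun y : ZM => Real.exp (-(a * (1 + ‖y‖ ^ 2) ^ 2)) :=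
  (contDiff_cmp a (n := 1)).differentiable one_ne_zero

/-- **`∂_p φ = −4a(1+‖x‖²)x_p · φ`.** [cite: Agmon1982, §1 (1.10)] -/
theorem pderiv_cmp (p : Fin 3 × Fin 3) (x : ZM) :
    pderiv p (fun y : ZM => Real.exp (-(a * (1 + ‖y‖ ^ 2) ^ 2))) x =
      -(4 * a * (1 + ‖x‖ ^ 2) * x p) * Real.exp (-(a * (1 + ‖x‖ ^ 2) ^ 2)) := by
  have hh : Differentiable ℝ fun y : ZM => a * (1 + ‖y‖ ^ 2) ^ 2 := (contDiff_quarticExp a (n := 1)).differentiable one_ne_zero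
  have hh' : Differentiable ℝ fun y : ZM => -(a * (1 + ‖y‖ ^ 2) ^ 2) := hh.neg
  rw [pderiv_exp hh']
  have e : pderiv p (fun y : ZM => -(a * (1 + ‖y‖ ^ 2) ^ 2)) x = -(4 * a * (1 + ‖x‖ ^ 2) * x p) := by
    have := pderiv_smul hh (-1) p x
    rw [← pderiv_quarticExp a p x]
    have e1 : (fun y : ZM => -(a * (1 + ‖y‖ ^ 2) ^ 2)) = (-1 : ℝ) • fun y : ZM => a * (1 + ‖y‖ ^ 2) ^ 2 := by
      funext y; simp
    rw [e1, this]; ring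
  rw [e]; ring

/-- **`∂_p∂_p φ = φ · (16a²(1+‖x‖²)²x_p² − 4a(2x_p² + 1 + ‖x‖²))`.** [cite: Agmon1982, §1 (1.10)] -/
theorem pderiv_pderiv_cmp (p : Fin 3 × Fin 3) (x : ZM) :
    pderiv p (pderiv p (fun y : ZM => Real.exp (-(a * (1 + ‖y‖ ^ 2) ^ 2)))) x =
      Real.exp (-(a * (1 + ‖x‖ ^ 2) ^ 2)) *
        (16 * a ^ 2 * (1 + ‖x‖ ^ 2) ^ 2 * x p ^ 2 - 4 * a * (2 * x p ^ 2 + (1 + ‖x‖ ^ 2))) := by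
  have e : pderiv p (fun y : ZM => Real.exp (-(a * (1 + ‖y‖ ^ 2) ^ 2))) =
      fun x => (-(4 * a)) * ((1 + ‖x‖ ^ 2) * (x p * Real.exp (-(a * (1 + ‖x‖ ^ 2) ^ 2)))) := by
    funext x; rw [pderiv_cmp]; ring
  rw [e]
  have hq := differentiable_one_add_norm_sq
  have hc := differentiable_coord p
  have hφ := differentiable_cmp a
  have h2 : Differentiable ℝ fun y : ZM => y p * Real.exp (-(a * (1 + ‖y‖ ^ 2) ^ 2)) := hc.mul hφ
  have h3 : Differentiable ℝ fun y : ZM => (1 + ‖y‖ ^ 2) * (y p * Real.exp (-(a * (1 + ‖y‖ ^ 2) ^ 2))) := hq.mul h2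
  rw [pderiv_fun_const_mul h3, pderiv_fun_mul hq h2, pderiv_fun_mul hc hφ, pderiv_one_add_norm_sq, pderiv_coord_self, pderiv_cmp]
  ring

/-- `Σ_p x_p² = ‖x‖²`. [cite: Agmon1982, §1 (1.10)] -/
theorem sum_coord_sq (x : ZM) : ∑ p, x p ^ 2 = ‖x‖ ^ 2 := by rw [EuclideanSpace.real_norm_sq_eq]

/-- **The Laplacian of the comparison function**: `Δφ(x) = φ(x) · (16a²(1+‖x‖²)²‖x‖² − 4a(11‖x‖² + 9))`. [cite: Agmon1982, §1 (1.10)] -/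
theorem laplacian_cmp (x : ZM) :
    laplacian (fun y : ZM => Real.exp (-(a * (1 + ‖y‖ ^ 2) ^ 2))) x =
      Real.exp (-(a * (1 + ‖x‖ ^ 2) ^ 2)) * (16 * a ^ 2 * (1 + ‖x‖ ^ 2) ^ 2 * ‖x‖ ^ 2 - 4 * a * (11 * ‖x‖ ^ 2 + 9)) := by
  rw [laplacian_def]
  simp_rw [pderiv_pderiv_cmp]
  have h1 : ∑ p : Fin 3 × Fin 3, 16 * a ^ 2 * (1 + ‖x‖ ^ 2) ^ 2 * x p ^ 2 = 16 * a ^ 2 * (1 + ‖x‖ ^ 2) ^ 2 * ‖x‖ ^ 2 := by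
    rw [← Finset.mul_sum, sum_coord_sq]
  have h2 : ∑ p : Fin 3 × Fin 3, 4 * a * (2 * x p ^ 2 + (1 + ‖x‖ ^ 2)) = 4 * a * (2 * ‖x‖ ^ 2 + 9 * (1 + ‖x‖ ^ 2)) := by
    rw [← Finset.mul_sum, Finset.sum_add_distrib, ← Finset.mul_sum, sum_coord_sq, Finset.sum_const, Finset.card_univ]
    simp only [Fintype.card_prod, Fintype.card_fin, nsmul_eq_mul]
    norm_num
  rw [← Finset.mul_sum, Finset.sum_sub_distrib, h1, h2]
  ring

end Calculus

end Literature.Analysis.OperatorTheory.YMMatrixModel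

end
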